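import Mathlib
import Literature.Analysis.FunctionSpaces.SobolevGradCommutatorSmooth
import Literature.Analysis.FunctionSpaces.SobolevDomainProofs
import Literature.Analysis.FunctionSpaces.MollificationLp
import HarnessLib

/-!
# The DiPerna–Lions first-order commutator, III: the smooth case converges (`R_{k_i}ψ + k_i ⋆ (ψ div u) → 0` in `L¹`)

Analysis/FunctionSpaces support file (everything proved), sequel of `SobolevGradCommutatorSmooth`.  For `ψ ∈ C_c^∞`,
`u ∈ L²` with whole-space weak gradient `Du`, and bump kernels `k_i = (φ i).normed μ` with `rOut(φ i) → 0`
(finite-dimensional real inner product space, additive Haar measure `μ` invariant under negation):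
`∫ ‖ ∫ ψ(y)⟪u(x) − u(y), ∇k_i(x−y)⟫ dy + ∫ k_i(x−y) ψ(y) tr Du(y) dy ‖ dx → 0`
(`tendsto_lintegral_gradCommutator_smooth`).  By `gradCommutator_eq_of_smooth` and the integration by parts
`∫ ψ(y)∇k_i(x−y) dy = ∫ k_i(x−y)∇ψ(y) dy` (`integral_smul_gradient_comp_sub_eq`) the integrand is
`⟪u(x), (k_i ⋆ ∇ψ − ∇ψ)(x)⟫ − ((k_i ⋆ ⟪∇ψ,u⟫)(x) − ⟪∇ψ,u⟫(x))`, and both mollification errors tend to `0`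
(`L²` resp. `L¹`, the tree's `tendsto_eLpNorm_normed_convolution_sub_self`); Cauchy–Schwarz for the first.
This is the smooth step of DiPerna–Lions 1989, Lemma II.1; the extension to `θ ∈ L²` by density with the uniform bound
`SobolevGradCommutatorL1.lintegral_enorm_gradCommutator_le` is the remaining step (not done here).

[cite: DiPernaLions1989, Lemma II.1 (proof, smooth case)]; [cite: AdamsFournier2003, Thm. 2.29 (c)]
-/

noncomputable section

open MeasureTheory Set Filter Metric Function Module ContinuousLinearMap
open scoped ENNReal NNReal InnerProductSpace Topology RealInnerProductSpace ContDiff Convolution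

namespace Literature.Analysis.FunctionSpaces

variable {H : Type*} [NormedAddCommGroup H] [InnerProductSpace ℝ H] [FiniteDimensional ℝ H]
  [MeasurableSpace H] [BorelSpace H]

section SmoothLimit

variable (μ : Measure H) [μ.IsAddHaarMeasure]
variable {u : H → H} {Du : H → H →L[ℝ] H} {ψ k : H → ℝ}

/-- Integration by parts against a kernel: `∫ ψ(y) ∇k(x−y) dy = ∫ k(x−y) ∇ψ(y) dy` for `ψ, k ∈ C_c^∞ × C^∞`
(the weak derivative of the smooth `ψ` is its gradient; tested with `k(x − ·)`). [cite: Evans2010, App. C.4 (Thm. 7, proof: Dᵅ(η_ε ⋆ f) = η_ε ⋆ Dᵅ f)] -/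
theorem integral_smul_gradient_comp_sub_eq (hψ : IsTestFunctionOn (⊤ : TopologicalSpace.Opens H) ψ)
    (hk : IsTestFunctionOn (⊤ : TopologicalSpace.Opens H) k) (x : H) :
    ∫ y, ψ y • gradient k (x - y) ∂μ = ∫ y, k (x - y) • gradient ψ y ∂μ := by
  have hψ1 : ContDiff ℝ 1 ψ := hψ.contDiff.of_le (by exact_mod_cast le_top)
  have hk1 : ContDiff ℝ 1 k := hk.contDiff.of_le (by exact_mod_cast le_top)
  have hw : HasWeakFDerivOn (⊤ : TopologicalSpace.Opens H) μ ψ (fderiv ℝ ψ) :=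
    HasWeakFDerivOn.of_contDiff_holds ⊤ μ hψ1
  -- continuity / compact support of both integrands
  have hgkc : Continuous (gradient k) := by
    have e : gradient k = fun y => (InnerProductSpace.toDual ℝ H).symm (fderiv ℝ k y) := rfl
    rw [e]; exact (InnerProductSpace.toDual ℝ H).symm.continuous.comp (hk.contDiff.continuous_fderiv (by simp))
  have hgψc : Continuous (gradient ψ) := by
    have e : gradient ψ = fun y => (InnerProductSpace.toDual ℝ H).symm (fderiv ℝ ψ y) := rfl
    rw [e]; exact (InnerProductSpace.toDual ℝ H).symm.continuous.comp (hψ.contDiff.continuous_fderiv (by simp))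
  have hgψs : HasCompactSupport (gradient ψ) := by
    have e : gradient ψ = (InnerProductSpace.toDual ℝ H).symm ∘ fderiv ℝ ψ := rfl
    rw [e]; exact (hψ.hasCompactSupport.fderiv (𝕜 := ℝ)).comp_left (map_zero _)
  have hI1 : Integrable (fun y => ψ y • gradient k (x - y)) μ :=
    (hψ.contDiff.continuous.smul (hgkc.comp (continuous_const.sub continuous_id))).integrable_of_hasCompactSupport
      hψ.hasCompactSupport.smul_right
  have hI2 : Integrable (fun y => k (x - y) • gradient ψ y) μ :=
    ((hk.contDiff.continuous.comp (continuous_const.sub continuous_id)).smul hgψc).integrable_of_hasCompactSupport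
      hgψs.smul_left
  refine ext_inner_left ℝ fun v => ?_
  rw [← integral_inner hI1, ← integral_inner hI2]
  have key := hw.integral_fderiv_smul_eq (fun y => k (x - y)) v (hk.comp_sub_left x)
  simp only [TopologicalSpace.Opens.coe_top, Measure.restrict_univ, fderiv_comp_sub_left_apply hk1,
    neg_smul, integral_neg, neg_inj] at key
  -- `key : ∫ (fderiv k (x - y) v) • ψ y = ∫ k (x - y) • fderiv ψ y v`
  have e1 : ∀ y, ⟪v, ψ y • gradient k (x - y)⟫ = (fderiv ℝ k (x - y) v) • ψ y := fun y => by
    rw [real_inner_smul_right, real_inner_comm]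
    simp only [gradient, InnerProductSpace.toDual_symm_apply, smul_eq_mul, mul_comm]
  have e2 : ∀ y, ⟪v, k (x - y) • gradient ψ y⟫ = k (x - y) • fderiv ℝ ψ y v := fun y => by
    rw [real_inner_smul_right, real_inner_comm]
    simp only [gradient, InnerProductSpace.toDual_symm_apply, smul_eq_mul]
  simp_rw [e1, e2]
  exact key

variable {ι : Type*} {l : Filter ι} {φ : ι → ContDiffBump (0 : H)}

/-- **The smooth case of the DiPerna–Lions commutator lemma converges**: for `ψ ∈ C_c^∞`, `u ∈ L²` with whole-space
weak gradient `Du`, and bump kernels `k_i` with `rOut → 0`,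
`∫ ‖∫ ψ(y)⟪u(x)−u(y), ∇k_i(x−y)⟫ dy + ∫ k_i(x−y)ψ(y) tr Du(y) dy‖ dx → 0`.
[cite: DiPernaLions1989, Lemma II.1 (proof, smooth case)] -/
theorem tendsto_lintegral_gradCommutator_smooth [μ.IsNegInvariant]
    (hu2 : MemLp u 2 μ) (hDu : HasWeakFDerivOn (⊤ : TopologicalSpace.Opens H) μ u Du)
    (hψ : IsTestFunctionOn (⊤ : TopologicalSpace.Opens H) ψ) (hφ : Tendsto (fun i => (φ i).rOut) l (𝓝 0)) :
    Tendsto (fun i => ∫⁻ x, ‖(∫ y, ψ y * ⟪u x - u y, gradient ((φ i).normed μ) (x - y)⟫ ∂μ) +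
        ∫ y, (φ i).normed μ (x - y) * ψ y * LinearMap.trace ℝ H (Du y : H →ₗ[ℝ] H) ∂μ‖ₑ ∂μ) l (𝓝 0) := by
  -- data
  have hul : LocallyIntegrable u μ := by
    have h := hDu.locallyIntegrableOn
    rwa [TopologicalSpace.Opens.coe_top, locallyIntegrableOn_univ] at h
  have hgψc : Continuous (gradient ψ) := by
    have e : gradient ψ = fun y => (InnerProductSpace.toDual ℝ H).symm (fderiv ℝ ψ y) := rfl
    rw [e]; exact (InnerProductSpace.toDual ℝ H).symm.continuous.comp (hψ.contDiff.continuous_fderiv (by simp))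
  have hgψs : HasCompactSupport (gradient ψ) := by
    have e : gradient ψ = (InnerProductSpace.toDual ℝ H).symm ∘ fderiv ℝ ψ := rfl
    rw [e]; exact (hψ.hasCompactSupport.fderiv (𝕜 := ℝ)).comp_left (map_zero _)
  have hgψ2 : MemLp (gradient ψ) 2 μ := hgψc.memLp_of_hasCompactSupport hgψs
  set w : H → ℝ := fun y => ⟪gradient ψ y, u y⟫ with hw
  have hwI : Integrable w μ := integrable_inner_of_hasCompactSupport μ hgψc hgψs hul
  have hw1 : MemLp w 1 μ := memLp_one_iff_integrable.2 hwI
  -- the two mollification errors tend to zero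
  have hA := tendsto_eLpNorm_normed_convolution_sub_self (μ := μ) hφ (p := 2) (by norm_num) ENNReal.ofNat_ne_top hgψ2
  have hB := tendsto_eLpNorm_normed_convolution_sub_self (μ := μ) hφ (p := 1) le_rfl ENNReal.one_ne_top hw1
  -- pointwise identity
  have hpt : ∀ i x, (∫ y, ψ y * ⟪u x - u y, gradient ((φ i).normed μ) (x - y)⟫ ∂μ) +
      ∫ y, (φ i).normed μ (x - y) * ψ y * LinearMap.trace ℝ H (Du y : H →ₗ[ℝ] H) ∂μ =
      ⟪u x, ((φ i).normed μ ⋆[lsmul ℝ ℝ, μ] gradient ψ - gradient ψ) x⟫ -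
        (((φ i).normed μ ⋆[lsmul ℝ ℝ, μ] w) x - w x) := by
    intro i x
    have hk : IsTestFunctionOn (⊤ : TopologicalSpace.Opens H) ((φ i).normed μ) :=
      ⟨(φ i).contDiff_normed, (φ i).hasCompactSupport_normed, by simp⟩
    rw [gradCommutator_eq_of_smooth μ hDu hψ (φ i).contDiff_normed x, integral_smul_gradient_comp_sub_eq μ hψ hk x,
      Pi.sub_apply, convolution_lsmul_swap, convolution_lsmul_swap, inner_sub_right]
    have e : ⟪u x, gradient ψ x⟫ = w x := by rw [hw, real_inner_comm]
    simp only [smul_eq_mul, e]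
    ring
  -- pointwise bound
  have hbd : ∀ i x, ‖(∫ y, ψ y * ⟪u x - u y, gradient ((φ i).normed μ) (x - y)⟫ ∂μ) +
      ∫ y, (φ i).normed μ (x - y) * ψ y * LinearMap.trace ℝ H (Du y : H →ₗ[ℝ] H) ∂μ‖ₑ ≤
      ‖u x‖ₑ * ‖((φ i).normed μ ⋆[lsmul ℝ ℝ, μ] gradient ψ - gradient ψ) x‖ₑ +
        ‖(((φ i).normed μ ⋆[lsmul ℝ ℝ, μ] w) - w) x‖ₑ := by
    intro i x
    rw [hpt i x]
    refine (enorm_sub_le).trans (add_le_add ?_ le_rfl)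
    calc ‖⟪u x, ((φ i).normed μ ⋆[lsmul ℝ ℝ, μ] gradient ψ - gradient ψ) x⟫‖ₑ
        = ENNReal.ofReal ‖⟪u x, ((φ i).normed μ ⋆[lsmul ℝ ℝ, μ] gradient ψ - gradient ψ) x⟫‖ := (ofReal_norm _).symm
      _ ≤ ENNReal.ofReal (‖u x‖ * ‖((φ i).normed μ ⋆[lsmul ℝ ℝ, μ] gradient ψ - gradient ψ) x‖) :=
          ENNReal.ofReal_le_ofReal (norm_inner_le_norm _ _)
      _ = ‖u x‖ₑ * ‖((φ i).normed μ ⋆[lsmul ℝ ℝ, μ] gradient ψ - gradient ψ) x‖ₑ := by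
          rw [ENNReal.ofReal_mul (norm_nonneg _), ofReal_norm, ofReal_norm]
  -- measurability of the two error terms
  have hgψl : LocallyIntegrable (gradient ψ) μ := hgψc.locallyIntegrable
  have hc1 : ∀ i, Continuous ((φ i).normed μ ⋆[lsmul ℝ ℝ, μ] gradient ψ) := fun i =>
    (φ i).hasCompactSupport_normed.continuous_convolution_left _ (φ i).continuous_normed hgψl
  have hc2 : ∀ i, Continuous ((φ i).normed μ ⋆[lsmul ℝ ℝ, μ] w) := fun i =>
    (φ i).hasCompactSupport_normed.continuous_convolution_left _ (φ i).continuous_normed hwI.locallyIntegrable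
  have hm1 : ∀ i, AEStronglyMeasurable ((φ i).normed μ ⋆[lsmul ℝ ℝ, μ] gradient ψ - gradient ψ) μ := fun i =>
    (hc1 i).aestronglyMeasurable.sub hgψc.aestronglyMeasurable
  -- integrate the bound
  have hint : ∀ i, ∫⁻ x, ‖(∫ y, ψ y * ⟪u x - u y, gradient ((φ i).normed μ) (x - y)⟫ ∂μ) +
      ∫ y, (φ i).normed μ (x - y) * ψ y * LinearMap.trace ℝ H (Du y : H →ₗ[ℝ] H) ∂μ‖ₑ ∂μ ≤
      eLpNorm u 2 μ * eLpNorm ((φ i).normed μ ⋆[lsmul ℝ ℝ, μ] gradient ψ - gradient ψ) 2 μ +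
        eLpNorm (((φ i).normed μ ⋆[lsmul ℝ ℝ, μ] w) - w) 1 μ := by
    intro i
    refine (lintegral_mono fun x => hbd i x).trans ?_
    have hmm : AEMeasurable (fun x => ‖u x‖ₑ * ‖((φ i).normed μ ⋆[lsmul ℝ ℝ, μ] gradient ψ - gradient ψ) x‖ₑ) μ :=
      hu2.1.enorm.mul (hm1 i).enorm
    rw [lintegral_add_left' hmm, eLpNorm_one_eq_lintegral_enorm]
    gcongr
    -- Cauchy–Schwarz
    have hcs := ENNReal.lintegral_mul_le_Lp_mul_Lq μ Real.HolderConjugate.two_two hu2.1.enorm (hm1 i).enorm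
    refine hcs.trans (le_of_eq ?_)
    rw [eLpNorm_eq_lintegral_rpow_enorm_toReal two_ne_zero ENNReal.ofNat_ne_top,
      eLpNorm_eq_lintegral_rpow_enorm_toReal two_ne_zero ENNReal.ofNat_ne_top]
    simp only [ENNReal.toReal_ofNat, one_div, Pi.sub_apply]
  -- squeeze
  have hU : Tendsto (fun i => eLpNorm u 2 μ * eLpNorm ((φ i).normed μ ⋆[lsmul ℝ ℝ, μ] gradient ψ - gradient ψ) 2 μ +
      eLpNorm (((φ i).normed μ ⋆[lsmul ℝ ℝ, μ] w) - w) 1 μ) l (𝓝 0) := by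
    have h1 := ENNReal.Tendsto.const_mul hA (Or.inr hu2.eLpNorm_ne_top)
    rw [mul_zero] at h1
    simpa using h1.add hB
  exact tendsto_of_tendsto_of_tendsto_of_le_of_le tendsto_const_nhds hU (fun _ => zero_le) hint

end SmoothLimit

end Literature.Analysis.FunctionSpaces

end
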